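import Summits.Ventures.CertifiedManyBodySolver.Upper.StripCells

/-!
# The open Hubbard strip in column-major order, I′: the DIAGONAL (next-nearest-neighbour) bonds, cell by cell

HONEST FRAMING: first certified bounds; not a superconductivity verdict; every number certified or
labelled float. NO NUMBER IS CLAIMED HERE (producer-free combinatorics of the open box).

Venture `Ventures/CertifiedManyBodySolver` (sr-mbsolver), the `t′`-general strip-cell transport theorem (VAR item
V13; scoping memo `hubbard-upper-eng-2/V13-SCOPING-g12.md`), PART 1/5. `Upper/StripCells.lean` blocks the
nearest-neighbour bonds of the `(C·c) × W` column-major box `rectBoxGraph (C·c) W` into the `C` cells of `c`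
consecutive columns. The open-cluster `t–t′` Hamiltonian `hubbardOpenBoxTT' a b t t' U = hamiltonian (rectBoxGraph a b) t U
+ hamiltonian (rectBoxDiagGraph a b) t' 0` (LeBlanc et al. (2015) eq. (1)) carries ONE MORE hopping term on the
diagonal graph `rectBoxDiagGraph` (`|Δx| = |Δy| = 1`). This file is the diagonal twin of part I:

* `rectBoxDiagGraph_adj_stripCells_symm_iff` — **the diagonal bonds of the big box, cell by cell**: a diagonal bond
  joins two sites of ONE cell that are diagonal neighbours in that cell's own `c × W` box, or it joins
  `(c-1, y₀)` of cell `b` to `(0, y₁)` of cell `b + 1` with `|y₀ − y₁| = 1` (`lineAdj y₀ y₁`; either orientation);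
* `ite_rectBoxDiagGraph_adj_cells`, `sum_ite_sum_ite_cols_lineAdj_eq`, `sum_sum_ite_lineAdj_comm`,
  **`sum_sum_ite_rectBoxDiagGraph_adj_cells`** — the corresponding splitting of sums over ordered diagonal bonds:
  the cells' own diagonal bond sums plus, for consecutive cells `b + 1 = b'` and rows `y₀ ∼ y₁`, the two
  orientations of the bond `((c-1, y₀) of b) — ((0, y₁) of b')`.

Parts 2–5: `Upper/StripCellWordsDiag.lean` (the two-row inter-cell Jordan–Wigner words),
`Upper/StripCellHamiltonianTTPrime.lean` (the blocked `t–t′` Hamiltonian and the cell bond matrix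
`stripCellBondMatrixTT'`), `Upper/StripCellStructureTTPrime.lean` (charges, Hermiticity, row sums),
`Theorems/R2cStripCellTTPrimeEnergyDensity.lean` (the row-makers and the claim-node packaging
`energyDensityTT'_le_of_exists_stripCellCertTT'`). References: LeBlanc et al., PRX 5 (2015) 041041, eq. (1)
[LeBlancEtAl2015]; Essler et al. (2005) §12.3.4 (Jordan–Wigner order) [EsslerEtAl2005].
-/

noncomputable section

open Matrix Finset
open scoped BigOperators

namespace Summit.Ventures.CertifiedManyBodySolver.Upper

open Literature.MathematicalPhysics.QuantumLattice

/-! ### The diagonal bonds of the big box, cell by cell -/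

section Bonds

variable {C c W : ℕ}

/-- **The diagonal bonds of the `(C·c) × W` open box, cell by cell**: a next-nearest-neighbour bond joins two
sites of ONE cell that are diagonal neighbours in that cell's own `c × W` open box, or it joins `(c-1, y₀)` of
cell `b` to `(0, y₁)` of cell `b + 1` with `lineAdj y₀ y₁` (either orientation). -/
theorem rectBoxDiagGraph_adj_stripCells_symm_iff (hc : 0 < c) (b b' : Fin C) (f f' : Fin c ×ₗ Fin W) :
    (rectBoxDiagGraph (C * c) W).Adj ((stripCells C c W).symm (b, f)) ((stripCells C c W).symm (b', f')) ↔
      (b = b' ∧ (rectBoxDiagGraph c W).Adj f f') ∨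
      ((b : ℕ) + 1 = b' ∧ (ofLex f).1 = ⟨c - 1, by omega⟩ ∧ (ofLex f').1 = ⟨0, hc⟩ ∧
          lineAdj ((ofLex f).2 : ℕ) (ofLex f').2) ∨
      ((b' : ℕ) + 1 = b ∧ (ofLex f).1 = ⟨0, hc⟩ ∧ (ofLex f').1 = ⟨c - 1, by omega⟩ ∧
          lineAdj ((ofLex f).2 : ℕ) (ofLex f').2) := by
  obtain ⟨f₁, f₂, f₃, f₄⟩ := cell_offset_facts hc (b : ℕ) (b' : ℕ)
  have h₁ := (ofLex f).1.isLt
  have h₂ := (ofLex f').1.isLt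
  simp only [rectBoxDiagGraph, lineAdj, stripCells_symm_snd, Fin.ext_iff, stripCells_symm_fst_val]
  omega

end Bonds

/-! ### Splitting diagonal bond sums over cells -/

section BondSums

variable {C c W : ℕ} {M : Type*} [AddCommMonoid M]

/-- The diagonal bond indicator of the big box at two cell sites, split into its three exclusive cases. -/
theorem ite_rectBoxDiagGraph_adj_cells (hc : 0 < c) (b b' : Fin C) (f f' : Fin c ×ₗ Fin W) (v : M) :
    (if (rectBoxDiagGraph (C * c) W).Adj ((stripCells C c W).symm (b, f)) ((stripCells C c W).symm (b', f'))
      then v else 0) =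
      (if b = b' ∧ (rectBoxDiagGraph c W).Adj f f' then v else 0) +
      (if (b : ℕ) + 1 = b' ∧ (ofLex f).1 = ⟨c - 1, by omega⟩ ∧ (ofLex f').1 = ⟨0, hc⟩ ∧
          lineAdj ((ofLex f).2 : ℕ) (ofLex f').2 then v else 0) +
      (if (b' : ℕ) + 1 = b ∧ (ofLex f).1 = ⟨0, hc⟩ ∧ (ofLex f').1 = ⟨c - 1, by omega⟩ ∧
          lineAdj ((ofLex f).2 : ℕ) (ofLex f').2 then v else 0) := by
  rw [if_congr (rectBoxDiagGraph_adj_stripCells_symm_iff hc b b' f f') rfl rfl]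
  refine ite_or_or_eq_add v ?_ ?_ ?_
  · rintro ⟨⟨h₁, -⟩, h₂, -⟩
    rw [Fin.ext_iff] at h₁
    omega
  · rintro ⟨⟨h₁, -⟩, h₂, -⟩
    rw [Fin.ext_iff] at h₁
    omega
  · rintro ⟨⟨h₁, -⟩, h₂, -⟩
    omega

/-- Pairs of cell sites in prescribed columns `j₀`, `j₁` and chain-adjacent rows: the sum runs over the
ordered pairs of adjacent rows. -/
theorem sum_ite_sum_ite_cols_lineAdj_eq (j₀ j₁ : Fin c) (G : (Fin c ×ₗ Fin W) → (Fin c ×ₗ Fin W) → M) :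
    (∑ f : Fin c ×ₗ Fin W, if (ofLex f).1 = j₀ then
        ∑ f' : Fin c ×ₗ Fin W, if (ofLex f').1 = j₁ then
          (if lineAdj ((ofLex f).2 : ℕ) (ofLex f').2 then G f f' else 0) else 0 else 0) =
      ∑ y₀ : Fin W, ∑ y₁ : Fin W,
        if lineAdj (y₀ : ℕ) y₁ then G (toLex (j₀, y₀)) (toLex (j₁, y₁)) else 0 := by
  have hre : ∀ g : (Fin c ×ₗ Fin W) → M, ∑ f, g f = ∑ j : Fin c, ∑ y : Fin W, g (toLex (j, y)) :=
    fun g => by rw [← Equiv.sum_comp (toLex : Fin c × Fin W ≃ (Fin c ×ₗ Fin W)), Fintype.sum_prod_type]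
  simp only [hre, ofLex_toLex, Finset.sum_ite_irrel, Finset.sum_const_zero, Fintype.sum_ite_eq']
  refine Finset.sum_congr rfl fun y₀ _ => Finset.sum_congr rfl fun y₁ _ => ?_
  congr 1

/-- Chain adjacency of rows is symmetric: a double row sum may exchange the roles of the two rows. -/
theorem sum_sum_ite_lineAdj_comm (G : Fin W → Fin W → M) :
    (∑ y₀ : Fin W, ∑ y₁ : Fin W, if lineAdj (y₀ : ℕ) y₁ then G y₀ y₁ else 0) =
      ∑ y₀ : Fin W, ∑ y₁ : Fin W, if lineAdj (y₀ : ℕ) y₁ then G y₁ y₀ else 0 := by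
  rw [Finset.sum_comm]
  refine Finset.sum_congr rfl fun y₀ _ => Finset.sum_congr rfl fun y₁ _ => if_congr ?_ rfl rfl
  unfold lineAdj
  exact or_comm

/-- **Diagonal bond sums of the `(C·c) × W` open box, cell by cell**: a sum over the ordered next-nearest-neighbour
pairs of the big box is the sum over the cells of the same sum for the cell's own `c × W` open box, plus, for
every pair of consecutive cells `b + 1 = b'` and every ordered pair of chain-adjacent rows `y₀ ∼ y₁`, the two
orientations of the bond `((c-1, y₀) of b) — ((0, y₁) of b')`. -/
theorem sum_sum_ite_rectBoxDiagGraph_adj_cells (hc : 0 < c)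
    (F : (Fin (C * c) ×ₗ Fin W) → (Fin (C * c) ×ₗ Fin W) → M) :
    (∑ p, ∑ q, if (rectBoxDiagGraph (C * c) W).Adj p q then F p q else 0) =
      (∑ b : Fin C, ∑ f : Fin c ×ₗ Fin W, ∑ f' : Fin c ×ₗ Fin W,
          if (rectBoxDiagGraph c W).Adj f f' then
            F ((stripCells C c W).symm (b, f)) ((stripCells C c W).symm (b, f')) else 0) +
      ∑ b : Fin C, ∑ b' : Fin C, if (b : ℕ) + 1 = b' then
          ∑ y₀ : Fin W, ∑ y₁ : Fin W, if lineAdj (y₀ : ℕ) y₁ then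
            (F ((stripCells C c W).symm (b, toLex (⟨c - 1, by omega⟩, y₀)))
                ((stripCells C c W).symm (b', toLex (⟨0, hc⟩, y₁))) +
              F ((stripCells C c W).symm (b', toLex (⟨0, hc⟩, y₁)))
                ((stripCells C c W).symm (b, toLex (⟨c - 1, by omega⟩, y₀)))) else 0 else 0 := by
  set e := stripCells C c W with he
  have hre : ∀ g : (Fin (C * c) ×ₗ Fin W) → M, ∑ p, g p = ∑ b : Fin C, ∑ f : Fin c ×ₗ Fin W, g (e.symm (b, f)) :=
    fun g => by rw [← Equiv.sum_comp e.symm, Fintype.sum_prod_type]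
  simp only [hre, he, ite_rectBoxDiagGraph_adj_cells hc, Finset.sum_add_distrib]
  rw [← he]
  -- block 1: diagonal bonds inside one cell
  have h1 : (∑ b : Fin C, ∑ f : Fin c ×ₗ Fin W, ∑ b' : Fin C, ∑ f' : Fin c ×ₗ Fin W,
      if b = b' ∧ (rectBoxDiagGraph c W).Adj f f' then F (e.symm (b, f)) (e.symm (b', f')) else 0) =
      ∑ b : Fin C, ∑ f : Fin c ×ₗ Fin W, ∑ f' : Fin c ×ₗ Fin W,
        if (rectBoxDiagGraph c W).Adj f f' then F (e.symm (b, f)) (e.symm (b, f')) else 0 := by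
    refine Finset.sum_congr rfl fun b _ => Finset.sum_congr rfl fun f _ => ?_
    rw [Finset.sum_comm]
    simp only [ite_and, Fintype.sum_ite_eq]
  -- blocks 2 and 3: diagonal bonds between consecutive cells, the two orientations
  have h23 : ∀ (j₀ j₁ : Fin c) (rel : Fin C → Fin C → Prop) [DecidableRel rel],
      (∑ b : Fin C, ∑ f : Fin c ×ₗ Fin W, ∑ b' : Fin C, ∑ f' : Fin c ×ₗ Fin W,
        if rel b b' ∧ (ofLex f).1 = j₀ ∧ (ofLex f').1 = j₁ ∧ lineAdj ((ofLex f).2 : ℕ) (ofLex f').2 then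
          F (e.symm (b, f)) (e.symm (b', f')) else 0) =
        ∑ b : Fin C, ∑ b' : Fin C, if rel b b' then
          ∑ y₀ : Fin W, ∑ y₁ : Fin W, if lineAdj (y₀ : ℕ) y₁ then
            F (e.symm (b, toLex (j₀, y₀))) (e.symm (b', toLex (j₁, y₁))) else 0 else 0 := by
    intro j₀ j₁ rel _
    refine Finset.sum_congr rfl fun b _ => ?_
    rw [Finset.sum_comm]
    refine Finset.sum_congr rfl fun b' _ => ?_
    simp only [ite_and, Finset.sum_ite_irrel, Finset.sum_const_zero]
    congr 1
    exact sum_ite_sum_ite_cols_lineAdj_eq j₀ j₁ _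
  rw [h1, h23 ⟨c - 1, by omega⟩ ⟨0, hc⟩ (fun b b' : Fin C => (b : ℕ) + 1 = b'),
    h23 ⟨0, hc⟩ ⟨c - 1, by omega⟩ (fun b b' : Fin C => (b' : ℕ) + 1 = b),
    Finset.sum_comm (f := fun b b' : Fin C => if (b' : ℕ) + 1 = b then
      ∑ y₀ : Fin W, ∑ y₁ : Fin W, if lineAdj (y₀ : ℕ) y₁ then
        F (e.symm (b, toLex (⟨0, hc⟩, y₀))) (e.symm (b', toLex (⟨c - 1, by omega⟩, y₁))) else 0 else 0),
    add_assoc, ← Finset.sum_add_distrib]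
  congr 1
  refine Finset.sum_congr rfl fun b _ => ?_
  rw [← Finset.sum_add_distrib]
  refine Finset.sum_congr rfl fun b' _ => ?_
  rw [ite_add_ite, add_zero]
  refine if_congr Iff.rfl ?_ rfl
  rw [sum_sum_ite_lineAdj_comm (fun y₀ y₁ =>
      F (e.symm (b', toLex (⟨0, hc⟩, y₀))) (e.symm (b, toLex (⟨c - 1, by omega⟩, y₁)))),
    ← Finset.sum_add_distrib]
  refine Finset.sum_congr rfl fun y₀ _ => ?_
  rw [← Finset.sum_add_distrib]
  refine Finset.sum_congr rfl fun y₁ _ => ?_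
  rw [ite_add_ite, add_zero]

end BondSums

end Summit.Ventures.CertifiedManyBodySolver.Upper

end
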